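import Mathlib.Algebra.BigOperators.Fin
import Mathlib.Algebra.Group.Nat.Even
import Mathlib.Algebra.Module.Defs
import Mathlib.Algebra.Ring.Commute
import Mathlib.Data.Fintype.BigOperators
import Mathlib.Data.Nat.ModEq
import Mathlib.Tactic.Abel
import Mathlib.Tactic.NormNum
import Mathlib.Tactic.Ring
import HarnessLib

/-!
# The twisted prism identity behind graded commutativity of the cup product

A. Hatcher, *Algebraic Topology*, CUP 2002, §3.2, proof of Theorem 3.11 (pp. 270–272 of the held
copy `book:hatchernd-algebraic-topology`): for a singular `n`-simplex `σ` let
`ρ(σ) = εₙ σ|[vₙ, …, v₀]`, `εₙ = (-1)^{n(n+1)/2}`, and let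
`P(σ) = ∑ᵢ (-1)ⁱ εₙ₋ᵢ σ|[v₀, …, vᵢ, vₙ, …, vᵢ]` (the prism operator of Thm. 2.10 for the
projection `Δⁿ × I → Δⁿ`, with the top vertices `wₙ, …, wᵢ` written in reverse order). Hatcher
checks `∂P + P∂ = ρ - 𝟙` by a cancellation of double sums.

This file isolates the purely combinatorial content of that computation. Every simplex occurring
in `∂P(σ) + P(∂σ)` is `σ` restricted along a *vertex map* `Fin (n+1) → Fin (n+1)` (not monotone in
general), namely `prismMap n i ∘ Fin.succAbove j` (the faces of the prism simplices) or
`Fin.succAbove k ∘ prismMap (n-1) i` (the prism simplices of the faces). We prove, for an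
arbitrary function `F` from vertex maps to an `R`-module (`TwistedPrism.sum_eq`,
`TwistedPrism.sum_eq_mul`):

`∑ᵢ ∑ⱼ (-1)ⁱ⁺ʲ εₙ₋ᵢ F(θᵢ ∘ δⱼ) + ∑ₖ ∑ᵢ (-1)ᵏ⁺ⁱ εₙ₋₁₋ᵢ F(δₖ ∘ θ'ᵢ) = εₙ F(rev) - F(id)` (`n ≥ 1`),

by exhibiting Hatcher's cancellation as an explicit fixed-point-free sign-reversing involution on
the index set (`TwistedPrism.inv`) and applying `Finset.sum_ninvolution`. The five families of
coincidences of vertex maps are `prismMap_comp_succAbove_of_lt` (terms `j < i` of `∂P` against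
terms `k ≤ i` of `P∂`), `prismMap_comp_succAbove_of_gt` (`i < j ≤ n` against `k > i`),
`prismMap_comp_succAbove_self` (the telescoping `j = i` / `j = n + 1` terms), and the two
survivors `prismMap_comp_succAbove_eq_rev` (`= ρ`) and `prismMap_comp_succAbove_eq_id` (`= 𝟙`).
The signs `εₙ` are `revSign`, with `εₙ₊₁ = (-1)ⁿ⁺¹ εₙ` and `ε_{p+q} = (-1)^{pq} ε_p ε_q`
(`revSign_succ`, `revSign_add`; Hatcher's "easily checked identities").

The application to singular cochains (the operators `ρ`, `P`, and Theorem 3.11 itself) is in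
`Literature.AlgebraicTopology.SingularHomology.CupProductProofs`.

## References

* A. Hatcher, *Algebraic Topology*, CUP 2002, §3.2, Theorem 3.11 and its proof.
-/

namespace Literature.AlgebraicTopology.SingularHomology

universe v w

/-! ### The signs `εₙ = (-1)^{n(n+1)/2}` -/

/-- The triangular number `n(n+1)/2`, the number of adjacent transpositions in the reversal of
`n + 1` vertices (Hatcher 2002, §3.2, proof of Thm. 3.11). [cite: Hatcher2002, §3.2 proof of Thm. 3.11] -/
def tri (n : ℕ) : ℕ := n * (n + 1) / 2

/-- `tri 0 = 0`. [cite: Hatcher2002, §3.2 proof of Thm. 3.11] -/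
lemma tri_zero : tri 0 = 0 := rfl

/-- `tri (n+1) = tri n + (n+1)`. [cite: Hatcher2002, §3.2 proof of Thm. 3.11] -/
lemma tri_succ (n : ℕ) : tri (n + 1) = tri n + (n + 1) := by
  unfold tri
  have h : (n + 1) * (n + 1 + 1) = n * (n + 1) + 2 * (n + 1) := by ring
  rw [h, Nat.add_mul_div_left _ _ (by norm_num : 0 < 2)]

/-- `tri (p+q) = tri p + tri q + pq` (behind `ε_{p+q} = (-1)^{pq} ε_p ε_q`, Hatcher 2002, §3.2,
proof of Thm. 3.11: "a trivial calculation"). [cite: Hatcher2002, §3.2 proof of Thm. 3.11] -/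
lemma tri_add (p q : ℕ) : tri (p + q) = tri p + tri q + p * q := by
  unfold tri
  have h : (p + q) * (p + q + 1) = (p * (p + 1) + q * (q + 1)) + 2 * (p * q) := by ring
  have hq : 2 ∣ q * (q + 1) := (Nat.even_mul_succ_self q).two_dvd
  rw [h, Nat.add_mul_div_left _ _ (by norm_num : 0 < 2), Nat.add_div_of_dvd_left hq]

variable (R : Type v) [CommRing R]

/-- Hatcher's sign `εₙ = (-1)^{n(n+1)/2} ∈ R` attached to the reversal of the vertices of an
`n`-simplex (Hatcher 2002, §3.2, proof of Thm. 3.11). [cite: Hatcher2002, §3.2 proof of Thm. 3.11] -/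
def revSign (n : ℕ) : R := (-1 : R) ^ tri n

/-- `ε₀ = 1`. [cite: Hatcher2002, §3.2 proof of Thm. 3.11] -/
@[simp]
lemma revSign_zero : revSign R 0 = 1 := by
  simp [revSign, tri_zero]

/-- `εₙ₊₁ = (-1)ⁿ⁺¹ εₙ` (Hatcher 2002, §3.2, proof of Thm. 3.11: "the easily checked identity
`εₙ = (-1)ⁿ εₙ₋₁`"). [cite: Hatcher2002, §3.2 proof of Thm. 3.11] -/
lemma revSign_succ (n : ℕ) : revSign R (n + 1) = (-1 : R) ^ (n + 1) * revSign R n := by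
  rw [revSign, revSign, tri_succ, pow_add, mul_comm]

/-- `ε_{p+q} = (-1)^{pq} ε_p ε_q` (Hatcher 2002, §3.2, proof of Thm. 3.11). [cite: Hatcher2002, §3.2 proof of Thm. 3.11] -/
lemma revSign_add (p q : ℕ) :
    revSign R (p + q) = (-1 : R) ^ (p * q) * (revSign R p * revSign R q) := by
  simp only [revSign, tri_add, pow_add]
  ring

/-- `εₙ εₙ = 1`. [cite: Hatcher2002, §3.2 proof of Thm. 3.11] -/
lemma revSign_mul_self (n : ℕ) : revSign R n * revSign R n = 1 := by
  rw [revSign, ← pow_add, ← two_mul, pow_mul, neg_one_sq, one_pow]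

/-- `ε_p ε_q = (-1)^{pq} ε_{p+q}` (Hatcher 2002, §3.2, proof of Thm. 3.11, the form in which the
sign identity is used: `ε_k ε_l (ρ^*φ ⌣ ρ^*ψ) = ε_{k+l} ρ^*(ψ ⌣ φ)`). [cite: Hatcher2002, §3.2 proof of Thm. 3.11] -/
lemma revSign_mul_revSign (p q : ℕ) :
    revSign R p * revSign R q = (-1 : R) ^ (p * q) * revSign R (p + q) := by
  rw [revSign_add, ← mul_assoc, ← pow_add, ← two_mul, pow_mul, neg_one_sq, one_pow, one_mul]

/-- `(-1)ᵃ = (-1)ᵇ` for `a ≡ b (mod 2)`. [folklore] -/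
lemma neg_one_pow_congr {a b : ℕ} (h : a % 2 = b % 2) : (-1 : R) ^ a = (-1 : R) ^ b := by
  rw [neg_one_pow_eq_pow_mod_two (R := R), h, ← neg_one_pow_eq_pow_mod_two]

/-- `(-1)ᵃ + (-1)ᵇ = 0` for `a + b` odd. [folklore] -/
lemma neg_one_pow_add_eq_zero {a b : ℕ} (h : (a + b) % 2 = 1) :
    (-1 : R) ^ a + (-1 : R) ^ b = 0 := by
  rw [neg_one_pow_congr R (show b % 2 = (a + 1) % 2 by omega), pow_succ]
  ring

namespace TwistedPrism

variable {n m : ℕ}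

/-! ### Hatcher's prism vertex maps -/

/-- The vertex map `Fin (n+2) → Fin (n+1)` of Hatcher's `i`-th twisted prism simplex
`(σπ)|[v₀, …, vᵢ, wₙ, …, wᵢ]` (`π : Δⁿ × I → Δⁿ` the projection): `j ↦ j` for `j ≤ i` and
`j ↦ n + i + 1 - j` for `j > i` (Hatcher 2002, §3.2, proof of Thm. 3.11, definition of `P`). [cite: Hatcher2002, §3.2 proof of Thm. 3.11] -/
def prismMap (n : ℕ) (i : Fin (n + 1)) : Fin (n + 2) → Fin (n + 1) :=
  fun j => if (j : ℕ) ≤ i then ⟨min j n, by omega⟩ else ⟨n - (j - i - 1), by omega⟩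

/-- Values of `prismMap`. [cite: Hatcher2002, §3.2 proof of Thm. 3.11] -/
@[simp]
lemma prismMap_val (i : Fin (n + 1)) (j : Fin (n + 2)) :
    ((prismMap n i j : Fin (n + 1)) : ℕ) = if (j : ℕ) ≤ i then (j : ℕ) else n - (j - i - 1) := by
  unfold prismMap
  split_ifs with h
  · simp only; omega
  · rfl

/-- Values of the coface maps `Fin.succAbove p` (`δ_p` skips `p`). [folklore] -/
lemma val_succAbove (p : Fin (n + 2)) (x : Fin (n + 1)) :
    ((p.succAbove x : Fin (n + 2)) : ℕ) = if (x : ℕ) < p then (x : ℕ) else x + 1 := by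
  unfold Fin.succAbove
  split_ifs with h₁ h₂ h₂
  · rfl
  · exact absurd h₁ (by rw [Fin.lt_def, Fin.val_castSucc]; exact h₂)
  · exact absurd h₂ (by rw [Fin.lt_def, Fin.val_castSucc] at h₁; exact h₁)
  · rfl

/-- Terms `j < i` of `∂P` are terms `k ≤ i'` of `P∂`:
`[v₀,…,v̂ⱼ,…,vᵢ,wₙ,…,wᵢ]` is the `(i-1)`-st prism simplex of the face `d_j σ`
(Hatcher 2002, §3.2, proof of Thm. 3.11, second sum of `P∂`). [cite: Hatcher2002, §3.2 proof of Thm. 3.11] -/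
lemma prismMap_comp_succAbove_of_lt (i : Fin (m + 2)) (j : Fin (m + 3)) (k : Fin (m + 2))
    (i' : Fin (m + 1)) (hj : (j : ℕ) < i) (hk : (k : ℕ) = j) (hi' : (i' : ℕ) = i - 1) :
    prismMap (m + 1) i ∘ Fin.succAbove j = Fin.succAbove k ∘ prismMap m i' := by
  funext x
  apply Fin.ext
  simp only [Function.comp_apply, prismMap_val, val_succAbove]
  split_ifs <;> omega

/-- The telescoping terms: the `i`-th face of the `i`-th prism simplex equals the last face of the
`(i-1)`-st one, `[v₀,…,vᵢ₋₁,wₙ,…,wᵢ]` (Hatcher 2002, §3.2, proof of Thm. 3.11: "the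
terms with `j = i` … cancel"). [cite: Hatcher2002, §3.2 proof of Thm. 3.11] -/
lemma prismMap_comp_succAbove_self (i i' : Fin (m + 2)) (j j' : Fin (m + 3))
    (hi : 1 ≤ (i : ℕ)) (hj : (j : ℕ) = i) (hi' : (i' : ℕ) = i - 1) (hj' : (j' : ℕ) = m + 2) :
    prismMap (m + 1) i ∘ Fin.succAbove j = prismMap (m + 1) i' ∘ Fin.succAbove j' := by
  funext x
  apply Fin.ext
  simp only [Function.comp_apply, prismMap_val, val_succAbove]
  split_ifs <;> omega

/-- Terms `i < j ≤ n` of `∂P` are terms `k > i'` of `P∂`: deleting a `w`-vertex,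
`[v₀,…,vᵢ,wₙ,…,ŵ,…,wᵢ]` is the `i`-th prism simplex of a face `d_k σ`, `k = n + 1 + i - j`
(Hatcher 2002, §3.2, proof of Thm. 3.11, first sum of `P∂`). [cite: Hatcher2002, §3.2 proof of Thm. 3.11] -/
lemma prismMap_comp_succAbove_of_gt (i : Fin (m + 2)) (j : Fin (m + 3)) (k : Fin (m + 2))
    (i' : Fin (m + 1)) (hij : (i : ℕ) < j) (hj : (j : ℕ) ≤ m + 1) (hk : (k : ℕ) = m + 2 + i - j)
    (hi' : (i' : ℕ) = i) :
    prismMap (m + 1) i ∘ Fin.succAbove j = Fin.succAbove k ∘ prismMap m i' := by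
  funext x
  apply Fin.ext
  simp only [Function.comp_apply, prismMap_val, val_succAbove]
  split_ifs <;> omega

/-- The survivor `εₙ [wₙ, …, w₀] = ρ(σ)`: the `0`-th face of the `0`-th prism simplex is the vertex
reversal (Hatcher 2002, §3.2, proof of Thm. 3.11). [cite: Hatcher2002, §3.2 proof of Thm. 3.11] -/
lemma prismMap_comp_succAbove_eq_rev (i : Fin (n + 1)) (j : Fin (n + 2)) (hi : (i : ℕ) = 0)
    (hj : (j : ℕ) = 0) : prismMap n i ∘ Fin.succAbove j = Fin.rev := by
  funext x
  apply Fin.ext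
  simp only [Function.comp_apply, prismMap_val, val_succAbove, Fin.val_rev]
  split_ifs <;> omega

/-- The survivor `-[v₀, …, vₙ] = -σ`: the last face of the last prism simplex is the identity
(Hatcher 2002, §3.2, proof of Thm. 3.11). [cite: Hatcher2002, §3.2 proof of Thm. 3.11] -/
lemma prismMap_comp_succAbove_eq_id (i : Fin (n + 1)) (j : Fin (n + 2)) (hi : (i : ℕ) = n)
    (hj : (j : ℕ) = n + 1) : prismMap n i ∘ Fin.succAbove j = id := by
  funext x
  apply Fin.ext
  simp only [Function.comp_apply, prismMap_val, val_succAbove, id]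
  split_ifs <;> omega

/-! ### The signs of the terms of `∂P` and `P∂` -/

/-- The sign `(-1)ⁱ⁺ʲ εₘ₊₁₋ᵢ` of the `j`-th face of the `i`-th prism simplex in `∂P(σ)`, `σ` of
dimension `m + 1` (Hatcher 2002, §3.2, proof of Thm. 3.11, formula for `∂P`). [cite: Hatcher2002, §3.2 proof of Thm. 3.11] -/
def sgn₁ (m i j : ℕ) : R := (-1 : R) ^ (i + j + tri (m + 1 - i))

/-- The sign `(-1)ᵏ⁺ⁱ εₘ₋ᵢ` of the `i`-th prism simplex of the `k`-th face in `P(∂σ)`, `σ` of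
dimension `m + 1` (Hatcher 2002, §3.2, proof of Thm. 3.11, formula for `P∂`). [cite: Hatcher2002, §3.2 proof of Thm. 3.11] -/
def sgn₂ (m k i : ℕ) : R := (-1 : R) ^ (k + i + tri (m - i))

/-- Sign cancellation for `prismMap_comp_succAbove_of_lt` (Hatcher 2002, §3.2, proof of
Thm. 3.11). [cite: Hatcher2002, §3.2 proof of Thm. 3.11] -/
lemma sgn₁_add_sgn₂_of_lt (i j : ℕ) (h : j < i) : sgn₁ R m i j + sgn₂ R m j (i - 1) = 0 := by
  unfold sgn₁ sgn₂
  rw [show m - (i - 1) = m + 1 - i by omega]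
  exact neg_one_pow_add_eq_zero R (by omega)

/-- Sign cancellation for the telescoping terms: `(-1)ⁿ⁺ⁱ εₙ₋ᵢ₊₁ = -εₙ₋ᵢ` (Hatcher 2002, §3.2,
proof of Thm. 3.11). [cite: Hatcher2002, §3.2 proof of Thm. 3.11] -/
lemma sgn₁_add_sgn₁_pred (i : ℕ) (h1 : 1 ≤ i) (h2 : i ≤ m + 1) :
    sgn₁ R m i i + sgn₁ R m (i - 1) (m + 2) = 0 := by
  unfold sgn₁
  rw [show m + 1 - (i - 1) = m + 1 - i + 1 by omega]
  have ht := tri_succ (m + 1 - i)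
  exact neg_one_pow_add_eq_zero R (by omega)

/-- Sign cancellation for `prismMap_comp_succAbove_of_gt`: `εₙ₋ᵢ = (-1)ⁿ⁻ⁱ εₙ₋ᵢ₋₁`
(Hatcher 2002, §3.2, proof of Thm. 3.11, last line of the proof). [cite: Hatcher2002, §3.2 proof of Thm. 3.11] -/
lemma sgn₁_add_sgn₂_of_gt (i j : ℕ) (h1 : i < j) (h2 : j ≤ m + 1) :
    sgn₁ R m i j + sgn₂ R m (m + 2 + i - j) i = 0 := by
  unfold sgn₁ sgn₂
  rw [show m + 1 - i = m - i + 1 by omega]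
  have ht := tri_succ (m - i)
  exact neg_one_pow_add_eq_zero R (by omega)

/-- The sign of the survivor `ρ(σ)` is `εₘ₊₁`. [cite: Hatcher2002, §3.2 proof of Thm. 3.11] -/
lemma sgn₁_zero_zero : sgn₁ R m 0 0 = revSign R (m + 1) := by
  simp [sgn₁, revSign]

/-- The sign of the survivor `σ` is `-1`. [cite: Hatcher2002, §3.2 proof of Thm. 3.11] -/
lemma sgn₁_last_last : sgn₁ R m (m + 1) (m + 2) = -1 := by
  unfold sgn₁
  rw [Nat.sub_self, tri_zero, neg_one_pow_congr R (show (m + 1 + (m + 2) + 0) % 2 = 1 % 2 by omega),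
    pow_one]

/-! ### Hatcher's cancellation as a sign-reversing involution -/

/-- The index set of all terms of `∂P(σ) + P(∂σ) - ρ(σ) + σ` for `σ` of dimension `m + 1`:
pairs `(i, j)` (faces `j ≤ m + 2` of prism simplices `i ≤ m + 1`), pairs `(k, i)` (prism simplices
`i ≤ m` of faces `k ≤ m + 1`), and the two survivors. [cite: Hatcher2002, §3.2 proof of Thm. 3.11] -/
abbrev Ind (m : ℕ) : Type := (Fin (m + 2) × Fin (m + 3)) ⊕ (Fin (m + 2) × Fin (m + 1)) ⊕ Bool

variable {R} {M : Type w} [AddCommGroup M] [Module R M]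

variable (R) in
/-- The signed terms of `∂P(σ) + P(∂σ) - ρ(σ) + σ`, for an arbitrary coefficient function `F` on
vertex maps (Hatcher 2002, §3.2, proof of Thm. 3.11). [cite: Hatcher2002, §3.2 proof of Thm. 3.11] -/
def term (m : ℕ) (F : (Fin (m + 2) → Fin (m + 2)) → M) : Ind m → M
  | Sum.inl (i, j) => sgn₁ R m i j • F (prismMap (m + 1) i ∘ Fin.succAbove j)
  | Sum.inr (Sum.inl (k, i)) => sgn₂ R m k i • F (Fin.succAbove k ∘ prismMap m i)
  | Sum.inr (Sum.inr false) => -(revSign R (m + 1) • F Fin.rev)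
  | Sum.inr (Sum.inr true) => F id

/-- Hatcher's pairing of cancelling terms, as a map of the index set: `j < i` ↔ `P∂`-terms with
`k ≤ i`; `j = i` ↔ `j = m + 2` (telescoping, with the two ends paired to the survivors);
`i < j ≤ m + 1` ↔ `P∂`-terms with `k > i` (Hatcher 2002, §3.2, proof of Thm. 3.11). [cite: Hatcher2002, §3.2 proof of Thm. 3.11] -/
def inv (m : ℕ) : Ind m → Ind m
  | Sum.inl (i, j) =>
      if (j : ℕ) < i then Sum.inr (Sum.inl (⟨min j (m + 1), by omega⟩, ⟨i - 1, by omega⟩))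
      else if (j : ℕ) = i then
        (if (i : ℕ) = 0 then Sum.inr (Sum.inr false)
          else Sum.inl (⟨i - 1, by omega⟩, ⟨m + 2, by omega⟩))
      else if (j : ℕ) ≤ m + 1 then
        Sum.inr (Sum.inl (⟨m + 1 - (j - i - 1), by omega⟩, ⟨min i m, by omega⟩))
      else (if (i : ℕ) = m + 1 then Sum.inr (Sum.inr true)
          else Sum.inl (⟨min (i + 1) (m + 1), by omega⟩, ⟨i + 1, by omega⟩))
  | Sum.inr (Sum.inl (k, i)) =>
      if (k : ℕ) ≤ i then Sum.inl (⟨i + 1, by omega⟩, ⟨k, by omega⟩)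
      else Sum.inl (⟨i, by omega⟩, ⟨m + 2 - (k - i), by omega⟩)
  | Sum.inr (Sum.inr false) => Sum.inl (⟨0, by omega⟩, ⟨0, by omega⟩)
  | Sum.inr (Sum.inr true) => Sum.inl (⟨m + 1, by omega⟩, ⟨m + 2, by omega⟩)

/-- `inv` is an involution. [cite: Hatcher2002, §3.2 proof of Thm. 3.11] -/
lemma inv_inv (a : Ind m) : inv m (inv m a) = a := by
  rcases a with ⟨i, j⟩ | ⟨k, i⟩ | (_ | _)
  · simp only [inv]
    split_ifs <;> (try dsimp only) <;> (try split_ifs) <;>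
      first
        | (exfalso; omega)
        | (simp only [Sum.inl.injEq, Prod.mk.injEq, Fin.ext_iff]; omega)
  · simp only [inv]
    split_ifs <;> (try dsimp only) <;> (try split_ifs) <;>
      first
        | (exfalso; omega)
        | (simp only [Sum.inr.injEq, Sum.inl.injEq, Prod.mk.injEq, Fin.ext_iff]; omega)
  · simp [inv]
  · simp [inv]

/-- `inv` has no fixed points. [cite: Hatcher2002, §3.2 proof of Thm. 3.11] -/
lemma inv_ne (a : Ind m) : inv m a ≠ a := by
  rcases a with ⟨i, j⟩ | ⟨k, i⟩ | (_ | _)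
  · simp only [inv]
    split_ifs <;>
      simp only [ne_eq, Sum.inl.injEq, Prod.mk.injEq, Fin.ext_iff, reduceCtorEq,
        not_false_eq_true] <;> omega
  · simp only [inv]
    split_ifs <;> simp
  · simp [inv]
  · simp [inv]

/-- `inv` is sign-reversing on `term`: paired terms cancel (Hatcher 2002, §3.2, proof of
Thm. 3.11: the five cancellations/identifications of the double sums). [cite: Hatcher2002, §3.2 proof of Thm. 3.11] -/
lemma term_add_term_inv (F : (Fin (m + 2) → Fin (m + 2)) → M) (a : Ind m) :
    term R m F a + term R m F (inv m a) = 0 := by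
  rcases a with ⟨i, j⟩ | ⟨k, i⟩ | (_ | _)
  · simp only [inv]
    split_ifs with h1 h2 h3 h4 h5
    · simp only [term]
      rw [prismMap_comp_succAbove_of_lt i j ⟨min j (m + 1), by omega⟩ ⟨i - 1, by omega⟩ h1
        (by simp only; omega) rfl, ← add_smul]
      have hs : sgn₁ R m i j + sgn₂ R m (min (j : ℕ) (m + 1)) (i - 1) = 0 := by
        rw [show min (j : ℕ) (m + 1) = j by omega]
        exact sgn₁_add_sgn₂_of_lt R _ _ h1
      rw [hs, zero_smul]
    · simp only [term]
      rw [prismMap_comp_succAbove_eq_rev i j h3 (by omega), h3, h2, h3, sgn₁_zero_zero,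
        add_neg_cancel]
    · simp only [term]
      rw [prismMap_comp_succAbove_self i ⟨i - 1, by omega⟩ j ⟨m + 2, by omega⟩ (by omega) h2 rfl
        rfl, ← add_smul]
      have hs : sgn₁ R m i j + sgn₁ R m (i - 1) (m + 2) = 0 := by
        rw [h2]
        exact sgn₁_add_sgn₁_pred R _ (by omega) (by omega)
      rw [hs, zero_smul]
    · simp only [term]
      rw [prismMap_comp_succAbove_of_gt i j ⟨m + 1 - (j - i - 1), by omega⟩ ⟨min i m, by omega⟩
        (by omega) h4 (by simp only; omega) (by simp only; omega), ← add_smul]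
      have hs : sgn₁ R m i j + sgn₂ R m (m + 1 - ((j : ℕ) - i - 1)) (min (i : ℕ) m) = 0 := by
        rw [show m + 1 - ((j : ℕ) - i - 1) = m + 2 + i - j by omega,
          show min (i : ℕ) m = i by omega]
        exact sgn₁_add_sgn₂_of_gt R _ _ (by omega) h4
      rw [hs, zero_smul]
    · simp only [term]
      rw [prismMap_comp_succAbove_eq_id i j h5 (by omega), h5, show (j : ℕ) = m + 2 by omega,
        sgn₁_last_last, neg_one_smul, neg_add_cancel]
    · simp only [term]
      rw [← prismMap_comp_succAbove_self ⟨min (i + 1) (m + 1), by omega⟩ i ⟨i + 1, by omega⟩ j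
        (by simp) (by simp only; omega) (by simp only; omega) (by omega), ← add_smul]
      have hs : sgn₁ R m i j + sgn₁ R m (min ((i : ℕ) + 1) (m + 1)) (i + 1) = 0 := by
        rw [show min ((i : ℕ) + 1) (m + 1) = i + 1 by omega, show (j : ℕ) = m + 2 by omega,
          add_comm]
        have := sgn₁_add_sgn₁_pred R (m := m) (i + 1) (by omega) (by omega)
        rwa [Nat.add_sub_cancel] at this
      rw [hs, zero_smul]
  · simp only [inv]
    split_ifs with h1
    · simp only [term]
      rw [prismMap_comp_succAbove_of_lt ⟨i + 1, by omega⟩ ⟨k, by omega⟩ k i (by simp only; omega)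
        rfl (by simp), ← add_smul]
      have hs : sgn₂ R m k i + sgn₁ R m (i + 1) k = 0 := by
        rw [add_comm]
        have := sgn₁_add_sgn₂_of_lt R (m := m) (i + 1) k (by omega)
        rwa [Nat.add_sub_cancel] at this
      rw [hs, zero_smul]
    · simp only [term]
      rw [prismMap_comp_succAbove_of_gt ⟨i, by omega⟩ ⟨m + 2 - (k - i), by omega⟩ k i
        (by simp only; omega) (by simp only; omega) (by simp only; omega) rfl, ← add_smul]
      have hs : sgn₂ R m k i + sgn₁ R m i (m + 2 - ((k : ℕ) - i)) = 0 := by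
        rw [add_comm]
        have := sgn₁_add_sgn₂_of_gt R (m := m) i (m + 2 - (k - i)) (by omega) (by omega)
        rwa [show m + 2 + i - (m + 2 - (k - i)) = k by omega] at this
      rw [hs, zero_smul]
  · simp only [inv, term]
    rw [prismMap_comp_succAbove_eq_rev (⟨0, by omega⟩ : Fin (m + 2)) (⟨0, by omega⟩ : Fin (m + 3))
      rfl rfl, sgn₁_zero_zero, neg_add_cancel]
  · simp only [inv, term]
    rw [prismMap_comp_succAbove_eq_id (⟨m + 1, by omega⟩ : Fin (m + 2))
      (⟨m + 2, by omega⟩ : Fin (m + 3)) rfl rfl, sgn₁_last_last, neg_one_smul, add_neg_cancel]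

variable (R) in
/-- **The twisted prism identity** (the combinatorial content of `∂P + P∂ = ρ - 𝟙`, Hatcher 2002,
§3.2, proof of Thm. 3.11), for an arbitrary function `F` from vertex maps
`Fin (m+2) → Fin (m+2)` to an `R`-module: the signed sum over the faces of the prism simplices
plus the signed sum over the prism simplices of the faces equals `εₘ₊₁ F(rev) - F(id)`. [cite: Hatcher2002, §3.2 proof of Thm. 3.11] -/
theorem sum_eq (F : (Fin (m + 2) → Fin (m + 2)) → M) :
    (∑ i : Fin (m + 2), ∑ j : Fin (m + 3),
        sgn₁ R m i j • F (prismMap (m + 1) i ∘ Fin.succAbove j)) +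
      ∑ k : Fin (m + 2), ∑ i : Fin (m + 1), sgn₂ R m k i • F (Fin.succAbove k ∘ prismMap m i) =
      revSign R (m + 1) • F Fin.rev - F id := by
  have h : ∑ a, term R m F a = 0 :=
    Finset.sum_ninvolution (inv m) (term_add_term_inv F) (fun a _ => inv_ne a)
      (fun a => Finset.mem_univ _) inv_inv
  rw [Fintype.sum_sum_type, Fintype.sum_sum_type, Fintype.sum_prod_type, Fintype.sum_prod_type,
    Fintype.sum_bool] at h
  simp only [term] at h
  rw [← sub_eq_zero, ← h]
  abel

variable (R) in
/-- The twisted prism identity for `R`-valued `F`, with the signs in the product form in which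
they arise from expanding `P(δφ)(σ) + δ(Pφ)(σ)` on singular cochains:
`∑ᵢ (-1)ⁱ εₘ₊₁₋ᵢ ∑ⱼ (-1)ʲ F(θᵢ ∘ δⱼ) + ∑ₖ (-1)ᵏ ∑ᵢ (-1)ⁱ εₘ₋ᵢ F(δₖ ∘ θ'ᵢ) = εₘ₊₁ F(rev) - F(id)`
(Hatcher 2002, §3.2, proof of Thm. 3.11). [cite: Hatcher2002, §3.2 proof of Thm. 3.11] -/
theorem sum_eq_mul (F : (Fin (m + 2) → Fin (m + 2)) → R) :
    (∑ i : Fin (m + 2), ∑ j : Fin (m + 3), ((-1 : R) ^ (i : ℕ) * revSign R (m + 1 - i)) *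
        ((-1 : R) ^ (j : ℕ) * F (prismMap (m + 1) i ∘ Fin.succAbove j))) +
      ∑ k : Fin (m + 2), ∑ i : Fin (m + 1), (-1 : R) ^ (k : ℕ) *
        (((-1 : R) ^ (i : ℕ) * revSign R (m - i)) * F (Fin.succAbove k ∘ prismMap m i)) =
      revSign R (m + 1) * F Fin.rev - F id := by
  have h := sum_eq R (M := R) F
  simp only [smul_eq_mul, sgn₁, sgn₂, pow_add] at h
  rw [← h]
  simp only [revSign]
  congr 1
  · exact Finset.sum_congr rfl fun i _ => Finset.sum_congr rfl fun j _ => by ring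
  · exact Finset.sum_congr rfl fun k _ => Finset.sum_congr rfl fun i _ => by ring

end TwistedPrism

end Literature.AlgebraicTopology.SingularHomology
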